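import HarnessLib
import Summits.AtomisticToContinuum.FouriersLaw.Theses.HiddenChargeMazur
import Summits.AtomisticToContinuum.FouriersLaw.Theorems.HiddenChargeMazurStaticKuboStubPoissonValue
import Summits.AtomisticToContinuum.FouriersLaw.Theorems.HiddenChargeMazurStaticKuboStubKuboPairing
import Summits.AtomisticToContinuum.FouriersLaw.Theorems.HiddenChargeMazurStaticKuboStubTwoPointGronwall
import Summits.AtomisticToContinuum.FouriersLaw.Theorems.HiddenChargeMazurStaticKuboStubBrownianSupGaussTail
import Summits.AtomisticToContinuum.FouriersLaw.Theorems.HiddenChargeMazurStaticKuboStubHighEnergyDecayRate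
import Summits.AtomisticToContinuum.FouriersLaw.Theorems.HiddenChargeMazurStaticKuboStubLocalSmoothingLipschitz
import Summits.AtomisticToContinuum.FouriersLaw.Theorems.HiddenChargeMazurStaticKuboStubLasotaYorke
import Summits.AtomisticToContinuum.FouriersLaw.Theorems.HiddenChargeMazurStaticKuboStubCorrectorLipschitz
import Summits.AtomisticToContinuum.FouriersLaw.Theorems.HiddenChargeMazurStaticKuboStubTransfer

/-!
# Crux `HiddenChargeMazur.StaticKubo` PROVED — line `birth` (= `registered`), rev 4, all stubs landed
(item `stmt-AtomisticToContinuum-13510`, route `route-AtomisticToContinuum-HiddenChargeMazur`;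
sub-problem `FouriersLaw`; continuation lead `prover-line-stmt-AtomisticToContinuum-13510-c1-0`, 2026-08-17;
rev 1 registrar `planner-skel-stmt-AtomisticToContinuum-13510-0`, revs 2–3 `prover-line-stmt-AtomisticToContinuum-13510-0`.)

Crux (FIXED, concluded BY NAME below): for `pinnedChain ω₂ lam β γ` (all `> 0`), under weak-NESS
uniqueness, along any steady-state family `μ`, for every `T > 0`, `N ≥ 2` and every response limit
`D = lim_{δ→0, δ≠0} totalCurrent(μ N (T+δ/2) (T−δ/2))/δ` there is `F ∈ C²(PhaseSpace N)` with
`|F| + |∂_p F| + |∂_q F| ≤ C e^{θH}` (`θ < 1/(2T)`), `L_{T,T} F = −J` pointwise (`J = Σ_i bondCurrent i`)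
and `D·(N−1)·T² = ∫ F·J dGibbs_{N,T}`.

## Rev 3 (closed part, unchanged)

`StaticKubo_of : stub_poissonValue → stub_gradientBound → stub_kuboPairing → StaticKubo` (sorry-free);
`stub_poissonValue` LANDED (p148198), `stub_kuboPairing` LANDED (p149101).  The one open stub,
`stub_gradientBound` (every value-class `C²` solution of `L_{T,T}F = −J` has the full growth clause), is
by the previous lead's sorry-free reduction (`Lines/birth_gradientBound_reduction.lean`,
`stub_gradientBound_of_witness` + `exists_const_of_valueClass`) exactly the weighted gradient bound
`|∇u| ≤ C e^{θ₁H}`, `θ₁ < 1/(2T)`, for the Kubo corrector `u⋆(x) = ∫₀^∞ P_tJ(x) dt`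
(`Corrector.corrector_smooth`: `u⋆ = u` a.e., `u ∈ C^∞`, `L u = −J`, `|u| ≤ K_ϑ e^{ϑH}` for all `0 < ϑ < 1/T`).

## Rev 4 — the reshaping of `stub_gradientBound` (this file)

A route to the weighted gradient bound that needs NO Malliavin calculus and NO quantitative Hörmander
estimate: a Doeblin–Fortet (Lasota–Yorke) inequality for the WEIGHTED PAIR-LIPSCHITZ seminorm
`K(φ) = sup_{0<‖x−y‖≤1} |φx − φy| / (‖x−y‖ (e^{θ₁Hx} + e^{θ₁Hy}))` under the unit-time equilibrium kernel
`P_1`:  `K(P_1 φ) ≤ ½ K(φ) + C₀ ‖φ e^{-ϑH}‖_∞`  (`0 < ϑ < θ₁ < 1/(2T)`), from three inputs: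

* SYNCHRONOUS COUPLING (`stub_twoPointGronwall`, deterministic): two starts driven by the SAME Brownian
  pair differ by the solution of a random ODE (the noise is additive and cancels); pathwise Grönwall with the
  local Lipschitz rate of the drift, `C₀(1 + √H)` on energy shells (quartic potentials: `‖Hess‖ ≲ 1 + q² ≲ 1 + √H`).
  With the fixed-time exponential moments (3.4) of the tree this costs a factor `e^{C√E}` per unit time.
* HIGH-ENERGY DISSIPATION WITH A RATE (`stub_highEnergyDecayRate`, from `stub_brownianSupGaussTail`): CEHR
  Thm 5.1 as proved in the tree (`pinnedChain_lintegral_exp_hamiltonian_small`: factor `½` above `E₀`)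
  re-run with a sub-Gaussian tail for the running supremum of the Brownian pair in place of the `O(h²)` Doob
  tail (the only polynomial leak of that proof: noise threshold `m₁a`, cells `τ ≤ 2Λ₀/a`, `a⁴ = E` ⇒ tail
  `e^{-ca³} = e^{-cE^{3/4}}`; printed rate (5.1): `e^{-C₁E}`):  `E_x e^{θH(X_1)} ≤ C e^{θH(x) − cH(x)^{3/4}}`
  for `H(x) ≥ E₀`.  Since `e^{C√E} e^{-cE^{3/4}/2} → 0`, coupled pairs at high energy CONTRACT the weighted
  seminorm.
* LOCAL SMOOTHING (`stub_localSmoothingLipschitz`): on a compact energy shell, for data supported in a compact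
  energy shell, `x ↦ P_tF(x)` is Lipschitz with constant `C sup|F|` — from the in-tree smooth transition density
  `p ∈ C^∞((0,∞)×Ω×Ω)` (`pinnedChain_exists_transitionDensity`, CEHR Prop. 3.2 via the in-tree Hörmander
  theorem) and the mean value inequality (sublevel sets of `H` are convex: `H` is convex).  Low-energy pairs are
  handled by splitting `φ = φχ_R + φ(1−χ_R)`: the first part by smoothing, the second is invisible unless the
  unit-time energy exceeds `R` (probability `≤ C_{E₀} e^{-θ₁R}`).

Iterating (`stub_correctorLipschitz`) along `φ_n = ∫_n^{n+1} P_tJ dt` (`P_1φ_n = φ_{n+1}` by Chapman–Kolmogorov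
+ Fubini; `‖φ_n e^{-ϑH}‖_∞ ≤ Cϱ^n` by the in-tree mixing `totalBondCurrent_decay`, CEHR Thm 2.13) gives
`K(φ_n) ≤ C n max(½,ϱ)^n`, summable, hence a weighted pair-Lipschitz bound for `u⋆ = Σ_n φ_n`; and
(`stub_transfer`) `u = u⋆` everywhere (both continuous), `|∂u| ≤ 2A e^{θ₁H}`, so `u` is the witness of
`stub_gradientBound_of_witness`.

Stubs (7 = stubs_max), dependencies carried as HYPOTHESES so that every stub is an independent statement:
`S1 stub_twoPointGronwall`, `S2 stub_brownianSupGaussTail`, `S3 stub_highEnergyDecayRate : S2 → …`,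
`S4 stub_localSmoothingLipschitz`, `S5 stub_lasotaYorke : S1 → S3core → S4 → …` (lead),
`S6 stub_correctorLipschitz : S5core → …`, `S7 stub_transfer : S6core → (registered stub_gradientBound)`.
Composition: `stub_gradientBound := S7 (S6 (S5 S1 (S3 S2) S4))`; `StaticKubo_of` unchanged.

Disproof used: none on file (`ledger crux ls`: no `Disproof.lean`, no `Negative/`, 2026-08-17).  Refuter evidence
respected: EVIDENCE_StaticKubo.md / StaticKuboHarmonicCalibration.py (the crux statement is untouched).
-/

noncomputable section

open MeasureTheory Filter Topology
open scoped NNReal ENNReal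
open Literature.MathematicalPhysics.KineticTheory.HeatConduction Literature.MathematicalPhysics.KineticTheory
open Literature.Probability.Process OscillatorChain

namespace Summit.AtomisticToContinuum.FouriersLaw.Cruxes.StaticKubo

namespace Birth

/-! ## The rev-3 stub `stub_gradientBound`, COMPOSED from the landed rev-4 stubs S1–S7

The seven rev-4 stubs and the two rev-3 stubs are the landed theorems `Stubs.stub_*` of
`Theorems/HiddenChargeMazurStaticKuboStub*.lean` (S1 p153595, S2 p153396, S3 p154697, S4 p153636, S5 p156451,
S6 p154790, S7 p153882; rev 3: `stub_poissonValue` p148198, `stub_kuboPairing` p149101); they are used by name. -/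

/-- **stub 1b — `stub_gradientBound` (weighted gradient regularity of value-class Poisson solutions), PROVED**
from the seven landed stubs of rev 4: `S7 (S6 (S5 S1 (S3 S2) S4))` — every `C²` solution of `L_{T,T}F = −J` in the
value class `|F| ≤ C e^{θH}` (`θ < 1/(2T)`) satisfies `|F| + |∂_{p_i}F| + |∂_{q_i}F| ≤ C' e^{θ'H}`, `θ' < 1/(2T)`.
[folklore] -/
theorem stub_gradientBound :
    ∀ ω₂ lam β γ : ℝ, 0 < ω₂ → 0 < lam → 0 < β → 0 < γ → ∀ P : Literature.MathematicalPhysics.KineticTheory.HeatConduction.OscillatorChain, P = Literature.MathematicalPhysics.KineticTheory.HeatConduction.pinnedChain ω₂ lam β γ → ∀ T : ℝ, 0 < T → ∀ N : ℕ, 2 ≤ N → ∀ F : Literature.MathematicalPhysics.KineticTheory.HeatConduction.PhaseSpace N → ℝ, ContDiff ℝ 2 F → (∃ C θ : ℝ, θ < 1 / (2 * T) ∧ ∀ z : Literature.MathematicalPhysics.KineticTheory.HeatConduction.PhaseSpace N, |F z| ≤ C * Real.exp (θ * P.hamiltonian N z)) → (∀ z : Literature.MathematicalPhysics.KineticTheory.HeatConduction.PhaseSpace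 N, P.generator N T T F z = -(∑ i : Fin N, P.bondCurrent N i z)) → ∃ C θ : ℝ, θ < 1 / (2 * T) ∧ ∀ (z : Literature.MathematicalPhysics.KineticTheory.HeatConduction.PhaseSpace N) (i : Fin N), |F z| + |Literature.MathematicalPhysics.KineticTheory.HeatConduction.partialP i F z| + |Literature.MathematicalPhysics.KineticTheory.HeatConduction.partialQ i F z| ≤ C * Real.exp (θ * P.hamiltonian N z) :=
  Stubs.stub_transfer (Stubs.stub_correctorLipschitz (Stubs.stub_lasotaYorke Stubs.stub_twoPointGronwall
    (Stubs.stub_highEnergyDecayRate Stubs.stub_brownianSupGaussTail) Stubs.stub_localSmoothingLipschitz))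

/-! ## The composition (sorry-free, unchanged since rev 3) -/

/-- **Skeleton theorem — the crux `HiddenChargeMazur.StaticKubo` BY NAME from the three rev-3 stub statements**
(sorry-free): take the value-class Poisson solution `F` of stub 1a, upgrade its growth clause by stub 1b,
and read off the identity `D·(N−1)·T² = ⟨F,J⟩` from stub 2 (which needs only the value bound). -/
theorem StaticKubo_of
    (hValue : ∀ ω₂ lam β γ : ℝ, 0 < ω₂ → 0 < lam → 0 < β → 0 < γ → ∀ P : Literature.MathematicalPhysics.KineticTheory.HeatConduction.OscillatorChain, P = Literature.MathematicalPhysics.KineticTheory.HeatConduction.pinnedChain ω₂ lam β γ → ∀ T : ℝ, 0 < T → ∀ N : ℕ, 2 ≤ N → ∃ F : Literature.MathematicalPhysics.KineticTheory.HeatConduction.PhaseSpace N → ℝ, ContDiff ℝ 2 F ∧ (∃ C θ : ℝ, θ < 1 / (2 * T) ∧ ∀ z : Literature.MathematicalPhysics.KineticTheory.HeatConduction.PhaseSpace N, |F z| ≤ C * Real.exp (θ * P.hamiltonian N z)) ∧ (∀ z : Literature.MathematicalPhysics.KineticTheory.HeatConduction.PhaseSpace N, P.generator N T T F z = -(∑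 i : Fin N, P.bondCurrent N i z)))
    (hGrad : ∀ ω₂ lam β γ : ℝ, 0 < ω₂ → 0 < lam → 0 < β → 0 < γ → ∀ P : Literature.MathematicalPhysics.KineticTheory.HeatConduction.OscillatorChain, P = Literature.MathematicalPhysics.KineticTheory.HeatConduction.pinnedChain ω₂ lam β γ → ∀ T : ℝ, 0 < T → ∀ N : ℕ, 2 ≤ N → ∀ F : Literature.MathematicalPhysics.KineticTheory.HeatConduction.PhaseSpace N → ℝ, ContDiff ℝ 2 F → (∃ C θ : ℝ, θ < 1 / (2 * T) ∧ ∀ z : Literature.MathematicalPhysics.KineticTheory.HeatConduction.PhaseSpace N, |F z| ≤ C * Real.exp (θ * P.hamiltonian N z)) → (∀ z : Literature.MathematicalPhysics.KineticTheory.HeatConduction.PhaseSpace N, P.generator N T T F z = -(∑ i : Fin N, P.bondCurrent N i z)) → ∃ C θ : ℝ, θ < 1 / (2 * T) ∧ ∀ (z : Literature.MathematicalPhysics.KineticTheory.HeatConduction.PhaseSpace N) (i : Fin N), |F z| + |Literature.MathematicalPhysics.KineticTheory.HeatConduction.partialP i F z| + |Literature.MathematicalPhysics.KineticTheory.HeatConduction.partialQ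 i F z| ≤ C * Real.exp (θ * P.hamiltonian N z))
    (hKubo : ∀ ω₂ lam β γ : ℝ, 0 < ω₂ → 0 < lam → 0 < β → 0 < γ → ∀ P : Literature.MathematicalPhysics.KineticTheory.HeatConduction.OscillatorChain, P = Literature.MathematicalPhysics.KineticTheory.HeatConduction.pinnedChain ω₂ lam β γ → (∀ (N : ℕ) (T_L T_R : ℝ), 0 < T_L → 0 < T_R → ∀ μ ν : MeasureTheory.Measure (Literature.MathematicalPhysics.KineticTheory.HeatConduction.PhaseSpace N), P.IsSteadyState N T_L T_R μ → P.IsSteadyState N T_L T_R ν → μ = ν) → ∀ μ : (N : ℕ) → ℝ → ℝ → MeasureTheory.Measure (Literature.MathematicalPhysics.KineticTheory.HeatConduction.PhaseSpace N), (∀ (N : ℕ) (T_L T_R : ℝ), 0 < T_L → 0 < T_R → P.IsSteadyState N T_L T_R (μ N T_L T_R)) → ∀ T : ℝ, 0 < T → ∀ N : ℕ, 2 ≤ N → ∀ D : ℝ, Filter.Tendsto (fun δ : ℝ => P.totalCurrent (μ N (T + δ / 2) (T - δ / 2)) / δ) (nhdsWithin 0 {(0 : ℝ)}ᶜ) (nhds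 D) → ∀ F : Literature.MathematicalPhysics.KineticTheory.HeatConduction.PhaseSpace N → ℝ, ContDiff ℝ 2 F → (∃ C θ : ℝ, θ < 1 / (2 * T) ∧ ∀ z : Literature.MathematicalPhysics.KineticTheory.HeatConduction.PhaseSpace N, |F z| ≤ C * Real.exp (θ * P.hamiltonian N z)) → (∀ z : Literature.MathematicalPhysics.KineticTheory.HeatConduction.PhaseSpace N, P.generator N T T F z = -(∑ i : Fin N, P.bondCurrent N i z)) → D * (((N : ℝ) - 1) * T ^ 2) = ∫ z, F z * (∑ i : Fin N, P.bondCurrent N i z) ∂(MeasureTheory.volume.tilted fun x => -P.hamiltonian N x / T)) :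
    _root_.Summit.AtomisticToContinuum.FouriersLaw.Theses.HiddenChargeMazur.StaticKubo := by
  intro ω₂ lam β γ hω hl hβ hγ P hP hU μ hμ T hT N hN D hD
  obtain ⟨F, hF2, hFv, hFL⟩ := hValue ω₂ lam β γ hω hl hβ hγ P hP T hT N hN
  exact ⟨F, hF2, hGrad ω₂ lam β γ hω hl hβ hγ P hP T hT N hN F hF2 hFv hFL, hFL,
    hKubo ω₂ lam β γ hω hl hβ hγ P hP hU μ hμ T hT N hN D hD F hF2 hFv hFL⟩

/-- **The crux `HiddenChargeMazur.StaticKubo`, PROVED**: the skeleton applied to the landed stubs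
(sorry-free; every `stub_*` above is a landed theorem of `Theorems/HiddenChargeMazurStaticKuboStub*.lean`). -/
theorem StaticKubo_skeleton :
    _root_.Summit.AtomisticToContinuum.FouriersLaw.Theses.HiddenChargeMazur.StaticKubo :=
  StaticKubo_of Stubs.stub_poissonValue stub_gradientBound Stubs.stub_kuboPairing

end Birth

end Summit.AtomisticToContinuum.FouriersLaw.Cruxes.StaticKubo

end
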